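import Summits.ResolutionOfSingularities.ResolutionOfSingularities.Theorems.EquisingularLiftEquisingularLiftNatSquareHensel
import Summits.ResolutionOfSingularities.ResolutionOfSingularities.Theorems.EquisingularLiftEquisingularLiftNatEquinodalJacobian
import Mathlib.LinearAlgebra.FiniteDimensional.Defs
import Mathlib.LinearAlgebra.Matrix.NonsingularInverse
import Mathlib.LinearAlgebra.Dimension.Constructions
import HarnessLib

/-!
# [OURS · L1 W4.5(b) · EL♮(3) · nose residue, door ν4 «EQUINODAL PLANAR NOSE», brick (D6-1) file C]
# THE EQUINODAL HENSEL LIFT `exists_equinodal_lift` — the (S1) supplier of NU4-SIZING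

Cell `res-hironaka`, LADDER-RESOLUTION rung L (D-0089), slot W4.5(b), crux chain w45b: child crux **EL♮(3)** =
stmt-ResolutionOfSingularities-20148 (parent EL♮ = stmt-…-20038); registered nose residue of record
`stub_elnat_three_nonisolated_nonUnobsNonHostedNestNoseBTriplePrime` (39th registration, CHILD v45 d73c58dccb65cdf1),
to be re-cut by the 41st = NOSE CUT «EQUINODAL» (REPLACE `¬ NoseHypHostedNestBTriplePrime₂ ↦ ¬ blob₃ᵉ`, desk R52 (D6-6)).
WIDTH seat res-L1-w45b-nose-w1 g3 (D-0157 DOOR 1), desk RULING R52 / WIDTH TABLE D6 row **(D6-1)**: «the supplier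
`exists_equinodal_lift` ≈ 1 L all-in = NU4-SIZING v5 f7486aab0e6e06a9 §0 (S1) items (m1)–(m5), §M M.2 (a)» (pen idea-2
g26; mechanism idea-3 g14 MEMO §N-C′ and sketch `NU4_M_sketch.lean` 4be55af70be20011, whose hypothesis list is reproduced
VERBATIM below with the Hessian discriminant inlined; the determinant form consumes `EqCertDet`-shaped data of idea-3's
`NU4_certEq_sketch.lean` 0efc2d2c05e81442 / nose-w4 (D6-3)). Signature posted for GATE G6 (g3) as
`L/res-L1-w45b-nose-w1/EquinodalLiftSig.lean` 6bc28efa781c8bda. This is file C of three (A = `…NatSquareHensel` ✓ p669583,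
B = `…NatEquinodalJacobian`). `--supports stmt-ResolutionOfSingularities-20148 --as helper`, counted 0.
OURS; NOT a statement of H. Hironaka's 2017 manuscript (nothing of [Hironaka2017] is asserted); AI-written, AI review
weaker than expert review. DEF-FREE; no `sorry`; standard axioms. EL♮(3) is NOT proved here; resolution in positive
characteristic is NOT proved here (dimension 3 is Cossart–Piltant 2008/2009 in print).

WHAT. `exists_equinodal_lift`: `O` a local ring complete for its maximal ideal (`IsAdicComplete (maximalIdeal O) O`; no
DVR / characteristic / Noetherian hypothesis), `ḡ ∈ k[x₀,x₁,x₂]` (`k` the residue field) homogeneous of degree `e`,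
`δ` marked points `n̄ i` in the chart `x₂ = 1` with `ḡ(n̄ i) = 0`, `∇ḡ(n̄ i) = 0`, NON-DEGENERATE affine Hessian
`H₀₀H₁₁ − H₀₁² ≠ 0` (ordinary double point, every characteristic incl. 2) and (CERT-EQ) «evaluation at the marked points
is surjective from the degree-`e` forms onto `k^δ`» ⇒ a degree-`e` form `g` over `O` with `map residue g = ḡ` and
marked vectors `n i` over `O` (chart `x₂ = 1`) reducing to the `n̄ i`, with `g(n i) = 0`, all three partials `= 0`, and
the affine Hessian a UNIT at each `n i`. `exists_equinodal_lift_of_det`: the same from `EqCertDet`-shaped data (`δ`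
pivot exponent vectors `m j` of degree `e` with invertible evaluation matrix). `exists_pivots_of_surjective`:
(CERT-EQ) ⇒ such pivots (linear algebra). `exists_isHomogeneous_lift`: homogeneous polynomials lift homogeneously.

HOW ((m1)–(m5) of NU4-SIZING §0). Lift `ḡ` to a homogeneous `g₀` over `O` (all coefficients, `homogeneousComponent`
of any lift); FREEZE the non-pivot coefficients and take as unknowns the `2δ` marked coordinates and `δ` corrections to
the pivot coefficients — the SQUARE marked-node system `nodeSystem g₀ m` of file B, which reduces modulo `𝔪` to
`nodeSystem ḡ m` (`map_nodeSystem`), vanishes at the special point `(0, n̄)` (`eval_spt_nodeSystem`) and has Jacobian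
determinant `det M̄ · ∏ (H₀₀H₁₁ − H₀₁²)(n̄ i) ≠ 0` there (`det_jacobian`); file A's square multivariate Hensel lemma
(`SquareHensel.exists_lift_of_residue`: standard smoothness of `(O[X]⧸(F))[1/jac]` + Mathlib
`Algebra.FormallySmooth.exists_mkₐ_comp_eq_of_isAdicComplete`) gives an `O`-root; read off `g = g₀ + Σ u_j x^(m j)` and
`n i = (x_i, y_i, 1)` (`eval_nodeSystem`); `∂₂ g (n i) = 0` by Euler's identity `Σ x_s ∂_s g = e·g`
(`IsHomogeneous.sum_X_mul_pderiv`); the Hessian is a unit because its residue is the given non-zero one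
(`residue_ne_zero_iff_isUnit`). NOT here (other D6 rows): the stage-0 predicate `EqCertAt₀`/`EqCertDet` and the
specimen certificate (nose-w4, D6-3), the node strict-transform chart lemma EQ3 (nose-w3, D6-2), the door / blob₃ᵉ Defs
(027 / lead-2, D6-4), the engine wiring (stub-2, D6-5), the rung and the 41st texts (lead-2, D6-6).

References (index only): equisingular deformations of nodal plane curves — Greuel–Lossen–Shustin, *Introduction to
Singularities and Deformations* (2007) II.2; Hensel for systems — Bourbaki, *Alg. Comm.* III §4 no. 5. [folklore]
-/

set_option linter.dupNamespace false

noncomputable section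

open MvPolynomial IsLocalRing

namespace Summit.ResolutionOfSingularities.ResolutionOfSingularities.Cruxes.EquisingularLiftNat.Sections.Equinodal

--BODY-C
/-- A homogeneous polynomial lifts along a surjective change of coefficients to a homogeneous polynomial of the same
degree (lift coefficientwise, then take the homogeneous component). [folklore] -/
theorem exists_isHomogeneous_lift {R S σ : Type*} [CommRing R] [CommRing S] (φ : R →+* S)
    (hφ : Function.Surjective φ) {e : ℕ} (q : MvPolynomial σ S) (hq : q.IsHomogeneous e) :
    ∃ p : MvPolynomial σ R, p.IsHomogeneous e ∧ map φ p = q := by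
  classical
  obtain ⟨p, hp⟩ := MvPolynomial.map_surjective φ hφ q
  refine ⟨homogeneousComponent e p, homogeneousComponent_isHomogeneous e p, ?_⟩
  have hcomp : map φ (homogeneousComponent e p) = homogeneousComponent e (map φ p) := by
    ext d
    simp only [coeff_map, coeff_homogeneousComponent]
    split_ifs <;> simp
  rw [hcomp, hp, homogeneousComponent_eq_self hq]

/-- reduction modulo the maximal ideal commutes with evaluation. -/
theorem residue_eval {O : Type*} [CommRing O] [IsLocalRing O] {σ : Type*} (v : σ → O) (q : MvPolynomial σ O) :
    residue O (eval v q) = eval (fun s => residue O (v s)) (map (residue O) q) := by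
  have h := MvPolynomial.ringHom_ext (f := (residue O).comp (eval v))
    (g := (eval fun s => residue O (v s)).comp (map (residue O))) (fun a => by simp) (fun s => by simp)
  exact RingHom.congr_fun h q

/-- **(S1) THE EQUINODAL HENSEL LIFT — determinant-certificate form** (`EqCertDet`-shaped data: `δ` pivot exponent
vectors `m j` of degree `e` whose evaluation matrix at the marked points is invertible). A degree-`e` ternary form `ḡ`
over the residue field of a local ring `O` complete for its maximal ideal, with `δ` marked points in the chart `x₂ = 1`
at which `ḡ` and its partials vanish, with NON-DEGENERATE affine Hessian `H₀₀H₁₁ − H₀₁² ≠ 0` (ordinary double points,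
every characteristic), lifts to a degree-`e` form `g` over `O` reducing to `ḡ`, together with `O`-valued coordinate
vectors `n i` (chart `x₂ = 1`) reducing to the marked points, at which `g` and all three partials vanish and the affine
Hessian is a unit. Proof = the square multivariate Hensel lemma (`SquareHensel.exists_lift_of_residue`) applied to the
marked-node system `nodeSystem g₀ m` of a homogeneous lift `g₀` of `ḡ` (non-pivot coefficients frozen), whose Jacobi block
at the special point is `det M̄ · ∏ Hessians ≠ 0` (`det_jacobian`); `∂₂` at the lifted points by Euler's identity.
[OURS · NU4-SIZING v5 §0 (S1) (m1)–(m5), §M M.2 (a) · desk R52 (D6-1)] -/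
theorem exists_equinodal_lift_of_det
    {O : Type*} [CommRing O] [IsLocalRing O] [IsAdicComplete (maximalIdeal O) O]
    {e δ : ℕ}
    (gbar : MvPolynomial (Fin 3) (ResidueField O)) (hgbar : gbar.IsHomogeneous e)
    (nbar : Fin δ → Fin 3 → ResidueField O) (hchart : ∀ i, nbar i 2 = 1)
    (hnode : ∀ i, eval (nbar i) gbar = 0 ∧ ∀ j, eval (nbar i) (pderiv j gbar) = 0)
    (hord : ∀ i, eval (nbar i) (pderiv 0 (pderiv 0 gbar)) * eval (nbar i) (pderiv 1 (pderiv 1 gbar))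
      - eval (nbar i) (pderiv 0 (pderiv 1 gbar)) ^ 2 ≠ 0)
    (m : Fin δ → (Fin 3 →₀ ℕ)) (hm : ∀ j, (m j).degree = e)
    (hdet : (Matrix.of fun i j => eval (nbar i) (monomial (m j) (1 : ResidueField O))).det ≠ 0) :
    ∃ (g : MvPolynomial (Fin 3) O) (n : Fin δ → Fin 3 → O),
      g.IsHomogeneous e ∧ MvPolynomial.map (residue O) g = gbar ∧
      (∀ i j, residue O (n i j) = nbar i j) ∧ (∀ i, n i 2 = 1) ∧
      (∀ i, eval (n i) g = 0 ∧ ∀ j, eval (n i) (pderiv j g) = 0) ∧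
      (∀ i, IsUnit (eval (n i) (pderiv 0 (pderiv 0 g)) * eval (n i) (pderiv 1 (pderiv 1 g))
        - eval (n i) (pderiv 0 (pderiv 1 g)) ^ 2)) := by
  classical
  -- a homogeneous lift `g₀` of `ḡ` (all coefficients; the non-pivot ones stay frozen)
  obtain ⟨g₀, hg₀, hg₀bar⟩ := exists_isHomogeneous_lift (residue O) residue_surjective gbar hgbar
  have hred : ∀ row : Idx δ, map (residue O) (nodeSystem g₀ m row) = nodeSystem gbar m row := fun row => by
    rw [map_nodeSystem, hg₀bar]
  -- the square multivariate Hensel lemma on the marked-node system at the special point `(0, n̄)`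
  obtain ⟨x, hx, hroot⟩ := SquareHensel.exists_lift_of_residue (nodeSystem g₀ m) (spt nbar)
    (fun row => by rw [hred]; exact eval_spt_nodeSystem gbar m nbar hchart hnode row)
    (by
      have hmat : (Matrix.of fun i j : Idx δ =>
            eval (spt nbar) (pderiv j (map (residue O) (nodeSystem g₀ m i)))) =
          Matrix.of fun i j : Idx δ => eval (spt nbar) (pderiv j (nodeSystem gbar m i)) := by
        ext i j; rw [Matrix.of_apply, Matrix.of_apply, hred]
      rw [hmat, det_jacobian gbar m nbar hchart (fun i r => (hnode i).2 _)]
      exact mul_ne_zero hdet (Finset.prod_ne_zero_iff.mpr fun i _ => hord i))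
  -- read off the form and the marked vectors
  refine ⟨formOf g₀ m (fun j => x (Sum.inl j)), nd x, ?_, ?_, ?_, fun i => rfl, ?_, ?_⟩
  · -- homogeneous of degree `e`
    refine hg₀.add (IsHomogeneous.sum _ _ _ fun j _ => ?_)
    exact (isHomogeneous_monomial _ (hm j)).C_mul _
  · -- reduces to `ḡ`: the coefficient corrections reduce to `0`
    have hu : ∀ j, residue O (x (Sum.inl j)) = 0 := fun j => by rw [hx]; rfl
    simp [formOf, hg₀bar, hu]
  · -- the marked vectors reduce to the marked points
    intro i j
    fin_cases j
    · simpa [nd, spt] using hx (Sum.inr (0, i))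
    · simpa [nd, spt] using hx (Sum.inr (1, i))
    · simp [nd, hchart i]
  · -- the form and its three partials vanish at the marked vectors
    have hval : ∀ i, eval (nd x i) (formOf g₀ m fun j => x (Sum.inl j)) = 0 := fun i => by
      have h := hroot (Sum.inl i)
      rwa [eval_nodeSystem] at h
    have hgrad : ∀ i (r : Fin 2),
        eval (nd x i) (pderiv (Fin.castSucc r) (formOf g₀ m fun j => x (Sum.inl j))) = 0 := fun i r => by
      have h := hroot (Sum.inr (r, i))
      rwa [eval_nodeSystem] at h
    have hghom : (formOf g₀ m fun j => x (Sum.inl j)).IsHomogeneous e := by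
      refine hg₀.add (IsHomogeneous.sum _ _ _ fun j _ => ?_)
      exact (isHomogeneous_monomial _ (hm j)).C_mul _
    intro i
    refine ⟨hval i, fun j => ?_⟩
    fin_cases j
    · exact hgrad i 0
    · exact hgrad i 1
    · -- Euler: `Σ_s x_s ∂_s g = e • g`, evaluated at the marked vector (`x₂ = 1`): only `s = 2` survives
      have hsum : ∑ s : Fin 3, eval (nd x i) (X s * pderiv s (formOf g₀ m fun j => x (Sum.inl j))) =
          eval (nd x i) (X (2 : Fin 3) * pderiv (2 : Fin 3) (formOf g₀ m fun j => x (Sum.inl j))) := by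
        apply Finset.sum_eq_single
        · intro s _ hs
          obtain ⟨r, rfl⟩ := Fin.exists_castSucc_eq.mpr hs
          rw [map_mul, hgrad i r, mul_zero]
        · intro h; exact absurd (Finset.mem_univ _) h
      have heuler := congrArg (eval (nd x i)) hghom.sum_X_mul_pderiv
      rw [map_sum, hsum, map_nsmul, hval i, smul_zero, map_mul, eval_X] at heuler
      simpa [nd] using heuler
  · -- the affine Hessians are units: their residues are the non-zero `H₀₀H₁₁ − H₀₁²` of `ḡ`
    intro i
    rw [← residue_ne_zero_iff_isUnit]
    have hnres : (fun s => residue O (nd x i s)) = nbar i := by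
      ext s
      fin_cases s
      · simpa [nd, spt] using hx (Sum.inr (0, i))
      · simpa [nd, spt] using hx (Sum.inr (1, i))
      · simp [nd, hchart i]
    have hg : map (residue O) (formOf g₀ m fun j => x (Sum.inl j)) = gbar := by
      have hu : ∀ j, residue O (x (Sum.inl j)) = 0 := fun j => by rw [hx]; rfl
      simp [formOf, hg₀bar, hu]
    simp only [map_sub, map_mul, map_pow, residue_eval, hnres, ← pderiv_map, hg]
    exact hord i

/-- **Pivot extraction (certificate (CERT-EQ) ⇒ `EqCertDet`-shaped data).** If evaluation at the `δ` marked points is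
SURJECTIVE from the degree-`e` forms onto `k^δ`, then some `δ` monomials of degree `e` have an invertible `δ × δ`
evaluation matrix at the marked points (the images of the degree-`e` monomials span `k^δ`; a spanning family contains a
basis; a basis of `k^δ` has `δ` members; their matrix has linearly independent columns). [folklore linear algebra] -/
theorem exists_pivots_of_surjective {k : Type*} [Field k] {e δ : ℕ} {σ : Type*} (nbar : Fin δ → σ → k)
    (hcert : Function.Surjective
      fun h : homogeneousSubmodule σ k e => fun i => eval (nbar i) (h : MvPolynomial σ k)) :
    ∃ m : Fin δ → (σ →₀ ℕ), (∀ j, (m j).degree = e) ∧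
      (Matrix.of fun i j => eval (nbar i) (monomial (m j) (1 : k))).det ≠ 0 := by
  classical
  -- the evaluation vectors of the degree-`e` monomials span `k^δ`
  let c : {d : σ →₀ ℕ // d.degree = e} → (Fin δ → k) := fun d i => eval (nbar i) (monomial d.1 (1 : k))
  let L : MvPolynomial σ k →ₗ[k] (Fin δ → k) :=
    LinearMap.pi fun i => (MvPolynomial.aeval (nbar i) : MvPolynomial σ k →ₐ[k] k).toLinearMap
  have hL : ∀ p : MvPolynomial σ k, L p = fun i => eval (nbar i) p := fun p => by
    ext i; simp [L]
  have hspan : Submodule.span k (Set.range c) = ⊤ := by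
    rw [eq_top_iff]
    rintro w -
    obtain ⟨h, rfl⟩ := hcert w
    have hh : (h : MvPolynomial σ k).IsHomogeneous e := h.2
    have hdeg : ∀ d ∈ (h : MvPolynomial σ k).support, d.degree = e := fun d hd => by
      by_contra hne
      exact (mem_support_iff.mp hd) (hh.coeff_eq_zero hne)
    have hmem : L (h : MvPolynomial σ k) ∈ Submodule.span k (Set.range c) := by
      rw [(h : MvPolynomial σ k).as_sum, map_sum]
      refine Submodule.sum_mem _ fun d hd => ?_
      have hmono : monomial d (coeff d (h : MvPolynomial σ k)) =
          coeff d (h : MvPolynomial σ k) • monomial d (1 : k) := by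
        rw [smul_monomial, smul_eq_mul, mul_one]
      rw [hmono, map_smul]
      exact Submodule.smul_mem _ _ (Submodule.subset_span ⟨⟨d, hdeg d hd⟩, by rw [hL]⟩)
    change (fun i => eval (nbar i) (h : MvPolynomial σ k)) ∈ _
    rwa [hL] at hmem
  -- a spanning family contains a basis, indexed by some `κ` of cardinality `δ`
  obtain ⟨κ, a, -, hspan', hli⟩ := exists_linearIndependent' k c
  rw [hspan] at hspan'
  let B : Module.Basis κ k (Fin δ → k) := Module.Basis.mk hli (by rw [hspan'])
  haveI : Fintype κ := FiniteDimensional.fintypeBasisIndex B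
  have hcard : Fintype.card κ = δ := by
    have h := Module.finrank_eq_card_basis B
    rw [Module.finrank_fin_fun] at h
    exact h.symm
  let eqv : Fin δ ≃ κ := (Fintype.equivFinOfCardEq hcard).symm
  refine ⟨fun j => (a (eqv j)).1, fun j => (a (eqv j)).2, ?_⟩
  -- the pivot matrix has linearly independent columns
  have hcols : LinearIndependent k
      (Matrix.of fun i j => eval (nbar i) (monomial (a (eqv j)).1 (1 : k))).col := by
    have hc : (Matrix.of fun i j => eval (nbar i) (monomial (a (eqv j)).1 (1 : k))).col = (c ∘ a) ∘ eqv := by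
      funext j i; rfl
    rw [hc]
    exact hli.comp _ eqv.injective
  have hU := Matrix.linearIndependent_cols_iff_isUnit.mp hcols
  rw [Matrix.isUnit_iff_isUnit_det] at hU
  exact hU.ne_zero

/-- **(S1) THE EQUINODAL HENSEL LIFT — §M M.2 (a) form, certificate = surjectivity (CERT-EQ).** A degree-`e` ternary form
`ḡ` over the residue field of a local ring `O` complete for its maximal ideal, with `δ` marked ORDINARY double points
in the chart `x₂ = 1` (`ḡ = ∇ḡ = 0`, `H₀₀H₁₁ − H₀₁² ≠ 0` — every characteristic) which impose independent conditions
on degree-`e` forms (evaluation `k[x]_e → k^δ` surjective), lifts to a degree-`e` form `g` over `O` reducing to `ḡ`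
with `O`-valued marked vectors reducing to the marked points at which `g` and its three partials vanish and the affine
Hessian is a unit (the node persists along the lift). `O`: any local ring with `IsAdicComplete (maximalIdeal O) O` — no
DVR / characteristic / Noetherian hypothesis. = `exists_equinodal_lift_of_det` after `exists_pivots_of_surjective`.
[OURS · NU4-SIZING v5 §M M.2 (a) hypothesis list verbatim (idea-3 sketch 4be55af70be20011), Hessian inlined · desk R52 (D6-1)] -/
theorem exists_equinodal_lift
    {O : Type*} [CommRing O] [IsLocalRing O] [IsAdicComplete (maximalIdeal O) O]
    {e δ : ℕ}
    (gbar : MvPolynomial (Fin 3) (ResidueField O)) (hgbar : gbar.IsHomogeneous e)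
    (nbar : Fin δ → Fin 3 → ResidueField O) (hchart : ∀ i, nbar i 2 = 1)
    (hnode : ∀ i, eval (nbar i) gbar = 0 ∧ ∀ j, eval (nbar i) (pderiv j gbar) = 0)
    (hord : ∀ i, eval (nbar i) (pderiv 0 (pderiv 0 gbar)) * eval (nbar i) (pderiv 1 (pderiv 1 gbar))
      - eval (nbar i) (pderiv 0 (pderiv 1 gbar)) ^ 2 ≠ 0)
    (hcert : Function.Surjective
      fun h : homogeneousSubmodule (Fin 3) (ResidueField O) e =>
        fun i => eval (nbar i) (h : MvPolynomial (Fin 3) (ResidueField O))) :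
    ∃ (g : MvPolynomial (Fin 3) O) (n : Fin δ → Fin 3 → O),
      g.IsHomogeneous e ∧ MvPolynomial.map (residue O) g = gbar ∧
      (∀ i j, residue O (n i j) = nbar i j) ∧ (∀ i, n i 2 = 1) ∧
      (∀ i, eval (n i) g = 0 ∧ ∀ j, eval (n i) (pderiv j g) = 0) ∧
      (∀ i, IsUnit (eval (n i) (pderiv 0 (pderiv 0 g)) * eval (n i) (pderiv 1 (pderiv 1 g))
        - eval (n i) (pderiv 0 (pderiv 1 g)) ^ 2)) := by
  obtain ⟨m, hm, hdet⟩ := exists_pivots_of_surjective nbar hcert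
  exact exists_equinodal_lift_of_det gbar hgbar nbar hchart hnode hord m hm hdet

end Summit.ResolutionOfSingularities.ResolutionOfSingularities.Cruxes.EquisingularLiftNat.Sections.Equinodal
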